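import Literature.NumberTheory.Automorphic.CMPrincipalSeriesSpherical       -- ★ `deltaChar_eq_one_of_mem_of_isCompact` (generic §1 there)
import Literature.NumberTheory.Automorphic.SmoothIndCellFunCompactSupport   -- ★ `SmoothInd.isLocallyConstant_toFun`
import HarnessLib

/-!
# The `Ξ`-quotient of `Ind_H^G(Ξ|_H · δ_H)`: the invariant `K`-integral `q(f) = ∫_K Ξ(κ)⁻¹ f(κ) dκ`
# (Bernstein–Zelevinsky 1976 §2.21–§2.29, 1977 §1.8–§1.9; Casselman 1995 §3.1, Prop. 6.4.1; Cartier 1979 §III.3–§IV.1)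

Topic `NumberTheory/Automorphic`; namespace `Literature.NumberTheory.Automorphic`.  THEOREMS ONLY (no definition, no instance, no notation,
no named fact, no `sorry`).  GENERIC over a topological group `G`, a closed subgroup `H ≤ G` (locally compact), a compact open subgroup
`K ≤ G` with `G = H · K` («Iwasawa»), a character `Ξ : G →* ℂˣ` with open kernel, and a one-dimensional representation `σ` of `H` acting by
the scalar `σ(b) = Ξ(b) · δ_H(b)` (`δ_H` = ★ `deltaChar`, Mathlib's `modularCharacter` convention `map (· * g) μ = δ(g) • μ`).
* `SmoothInd.exists_charSpherical` — THE `Ξ`-SPHERICAL VECTOR: `f₀ ∈ Ind_H^G σ` (★ `Representation.SmoothInd`) with `f₀(b κ) = Ξ(b) δ_H(b) Ξ(κ)`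
  (`b ∈ H`, `κ ∈ K`; well defined because `δ_H = 1` on the compact `H ∩ K`, smooth because right-invariant under the open `K ∩ ker Ξ`).
* `SmoothInd.integral_charInv_mul_indicator_toFun_eq` — THE `H`-PERIOD OF THE CUT-OFF: for `f ∈ Ind_H^G σ` and EVERY `x ∈ G`,
  `∫_H Ξ(b)⁻¹ (1_K f)(b x) dμ_H(b) = μ_H(H ∩ K) · f(x)` (Iwasawa `x = b₁ κ₁`, the modular substitution `∫ φ(b b₁) db = δ_H(b₁) ∫ φ db`,
  `f(b₁ κ₁) = Ξ(b₁) δ_H(b₁) f(κ₁)`, `δ_H = 1` on `H ∩ K`).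
* **`SmoothInd.exists_charQuotientFunctional`** — for `G` unimodular (a Haar measure `ν` that is also right invariant), Haar measures `μ_H`, `μ_K`
  and the SWAPPED `G = H · K` disintegration `∫_G F dν = C ∫_K ∫_H F(b k) dμ_H dμ_K` (hypothesis `hform`; e.g. ★
  `UnitaryGroup.exists_integral_eq_mul_integral_compact_borel`), and ANY realisation `π` of right translation on `Ind_H^G σ`
  (`(π g f)(x) = f(x g)`, e.g. ★ `Representation.smoothIndRep`, ★ `UnitaryGroup.cmPrincipalSeries`): there is a linear functional `q` on `Ind_H^G σ`
  with `q ≠ 0` and `q(π(g) f) = Ξ(g) · q(f)`.  `q(f) := ∫_K Ξ(κ⁻¹) f(κ) dμ_K`; `q(f₀) = μ_K(K) ≠ 0`; equivariance: with `φ_f := 1_K · f`,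
  `∫_G Ξ(y⁻¹) φ_f(y g) dν(y)` equals `C · μ_H(H ∩ K) · q(π(g) f)` by `hform` and the `H`-period, and `Ξ(g) · ∫_G Ξ(y⁻¹) φ_f(y) dν(y)` by right invariance.
Consumer: cell hodgecm-mathlib (FLOOR 0), crux `H413` = `stmt-HodgeConjecture-24833`, P3b line «CMCharIdentityTest» stub (H4) `stub_uTwoCharQuotient`
(`ξ₂ = (η_v ψ_v) ∘ det` is a quotient of `i(χH₂)` on `U(Φ₂)(L⁺_v)`), through `Summits/…/Theorems/F0P3bU2XiQuotientFunctional.lean`.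
HONEST LABEL: HC_CM is proved only modulo the 2 remaining named inputs (hLiu418, h413) until rung 0 closes; this file pays no letter by itself.

## References
* [BernsteinZelevinsky1976] I. N. Bernstein, A. V. Zelevinsky, *Representations of the group GL(n,F) where F is a non-archimedean local field*,
  Russian Math. Surveys 31:3 (1976), §2.21–§2.29 (induction from a closed subgroup, the `δ`-normalisation, the invariant functional).
* [BernsteinZelevinsky1977] I. N. Bernstein, A. V. Zelevinsky, *Induced representations of reductive 𝔭-adic groups I*, Ann. Sci. ÉNS 10 (1977), §1.8–§1.9.
* [Casselman1995] W. Casselman, *Introduction to the theory of admissible representations of p-adic reductive groups* (1995), §3.1, Prop. 6.4.1.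
* [CartierCorvallis1979] P. Cartier, *Representations of p-adic groups: a survey*, PSPM 33.1 (1979), §III.3–§IV.1.

## Mathlib / tree search
Mathlib: `Measure.map_right_mul_eq_modularCharacterFun_smul`, `integral_mul_right_eq_self`, `integral_indicator_const`, `integral_map_equiv`,
`integral_smul_nnreal_measure`, `IsOpen.measure_pos`.  Tree (★): `Representation.SmoothInd` ∕ `smoothInd` ∕ `indFun` ∕ `mem_indFun_iff` ∕ `SmoothInd.toFun_subgroup_mul`
(`SmoothInduction`), `isSmoothVector_of_le` ∕ `mem_stabilizerSubgroup` (`SmoothRepresentation`), `SmoothInd.isLocallyConstant_toFun`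
(`SmoothIndCellFunCompactSupport`), `deltaChar` ∕ `deltaChar_apply` (`JacquetModule`), `deltaChar_eq_one_of_mem_of_isCompact` (`CMPrincipalSeriesSpherical` §1),
`Representation.exists_mem_fixedPoints_toFun_eq` (`SmoothInductionSphericalLine`, the `Ξ = 1` case of the spherical vector).
`lean search 'charQuotient|xiQuotient|charSpherical'`: no prior declaration.
-/

set_option autoImplicit false

noncomputable section

open MeasureTheory MeasureTheory.Measure Topology
open scoped NNReal

namespace Literature.NumberTheory.Automorphic

variable {G : Type*} [Group G] [TopologicalSpace G] [IsTopologicalGroup G]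
  {H : Subgroup G} [LocallyCompactSpace ↥H] {σ : Representation ℂ ↥H ℂ} {Ξ : G →* ℂˣ}

/-! ## §1 The `Ξ`-spherical vector `f₀(b κ) = Ξ(b) δ_H(b) · Ξ(κ)` -/

/-- **THE `Ξ`-SPHERICAL VECTOR OF `Ind_H^G(Ξ|_H · δ_H)`**: if `σ(b) = Ξ(b) δ_H(b)` on `H`, `Ξ` has open kernel, `K` is a compact open subgroup and
`G = H · K`, there is `f₀ ∈ Ind_H^G σ` with `f₀(b κ) = Ξ(b) δ_H(b) Ξ(κ)` for `b ∈ H`, `κ ∈ K` (well defined because `δ_H = 1` on the compact `H ∩ K`;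
smooth because right-invariant under the open `K ∩ ker Ξ`).  The `Ξ`-twisted form of ★ `Representation.exists_mem_fixedPoints_toFun_eq`.
[cite: CartierCorvallis1979, §III.3] [cite: BernsteinZelevinsky1976, §2.21] -/
theorem SmoothInd.exists_charSpherical (hH : IsClosed (H : Set G))
    (hσ : ∀ (b : ↥H) (z : ℂ), σ b z = ((Ξ b : ℂˣ) : ℂ) * ((deltaChar H b : ℂˣ) : ℂ) * z)
    (hΞo : IsOpen ((Ξ.ker : Subgroup G) : Set G))
    {K : Subgroup G} (hKc : IsCompact (K : Set G)) (hKo : IsOpen (K : Set G))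
    (hGK : ∀ g : G, ∃ h : ↥H, ∃ κ ∈ K, g = h * κ) :
    ∃ f₀ : Representation.SmoothInd H σ, ∀ (b : ↥H) (κ : G), κ ∈ K →
      f₀.toFun ((b : G) * κ) = ((Ξ b : ℂˣ) : ℂ) * ((deltaChar H b : ℂˣ) : ℂ) * ((Ξ κ : ℂˣ) : ℂ) := by
  classical
  -- Iwasawa `G = H · K`
  choose hh κκ hκκ hdec using hGK
  -- `δ_H = 1` on `H ∩ K`
  have hδ1 : ∀ c : ↥H, (c : G) ∈ K → deltaChar H c = 1 := fun c hc =>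
    deltaChar_eq_one_of_mem_of_isCompact H (C := K.comap H.subtype) (hH.isClosedEmbedding_subtypeVal.isCompact_preimage hKc) hc
  -- the scalar `S(b) = Ξ(b) δ_H(b)` as a character of `H`
  obtain ⟨S, hS⟩ : ∃ S : ↥H →* ℂˣ, S = (Ξ.comp H.subtype) * deltaChar H := ⟨_, rfl⟩
  have hSapp : ∀ b : ↥H, S b = Ξ b * deltaChar H b := fun b => by rw [hS]; rfl
  -- well-definedness on `H · K`
  have hwd : ∀ (h h' : ↥H) (κ κ' : G), κ ∈ K → κ' ∈ K → (h : G) * κ = h' * κ' →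
      ((S h : ℂˣ) : ℂ) * (Ξ κ : ℂ) = ((S h' : ℂˣ) : ℂ) * (Ξ κ' : ℂ) := by
    intro h h' κ κ' hκ hκ' heq
    -- `c := h'⁻¹ h ∈ H ∩ K`, `κ' = c κ`
    have hcκ : ((h'⁻¹ * h : ↥H) : G) * κ = κ' := by
      rw [Subgroup.coe_mul, Subgroup.coe_inv, mul_assoc, heq, inv_mul_cancel_left]
    have hcK : ((h'⁻¹ * h : ↥H) : G) ∈ K := by
      have : ((h'⁻¹ * h : ↥H) : G) = κ' * κ⁻¹ := by rw [← hcκ, mul_inv_cancel_right]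
      rw [this]
      exact K.mul_mem hκ' (K.inv_mem hκ)
    have hSc : S (h'⁻¹ * h) = Ξ ((h'⁻¹ * h : ↥H) : G) := by rw [hSapp, hδ1 _ hcK, mul_one]
    have hh' : h = h' * (h'⁻¹ * h) := by rw [mul_inv_cancel_left]
    rw [← hcκ, map_mul, Units.val_mul, ← hSc]
    conv_lhs => rw [hh', map_mul, Units.val_mul]
    ring
  -- the function
  obtain ⟨F, hFdef⟩ : ∃ F : G → ℂ, F = fun g => ((S (hh g) : ℂˣ) : ℂ) * (Ξ (κκ g) : ℂ) := ⟨_, rfl⟩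
  have hF : ∀ (g : G) (h : ↥H) (κ : G), κ ∈ K → g = h * κ → F g = ((S h : ℂˣ) : ℂ) * (Ξ κ : ℂ) := fun g h κ hκ hg => by
    rw [hFdef]
    exact hwd (hh g) h (κκ g) κ (hκκ g) hκ ((hdec g).symm.trans hg)
  -- `H`-equivariance: `F(b g) = σ(b) F(g) = S(b) F(g)`
  have hFmem : F ∈ Representation.coindV H.subtype σ := by
    rw [Representation.mem_indFun_iff]
    intro b g
    rw [hσ b (F g)]
    have e1 := hF ((b : G) * g) (b * hh g) (κκ g) (hκκ g) (by rw [Subgroup.coe_mul, mul_assoc, ← hdec g])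
    refine e1.trans ?_
    rw [hF g (hh g) (κκ g) (hκκ g) (hdec g), map_mul, Units.val_mul, hSapp b, Units.val_mul]
    ring
  -- right `K ∩ ker Ξ`-invariance ⇒ smooth
  have hFK : ∀ κ₀ : G, κ₀ ∈ K → Ξ κ₀ = 1 → ∀ x, F (x * κ₀) = F x := by
    intro κ₀ hκ₀ hΞ1 x
    rw [hF (x * κ₀) (hh x) (κκ x * κ₀) (K.mul_mem (hκκ x) hκ₀) (by rw [← mul_assoc, ← hdec x]), map_mul, hΞ1, mul_one,
      hF x (hh x) (κκ x) (hκκ x) (hdec x)]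
  have hopen : IsOpen ((K ⊓ Ξ.ker : Subgroup G) : Set G) := hKo.inter hΞo
  have hFsm : (Representation.indFun H σ).IsSmoothVector (⟨F, hFmem⟩ : Representation.coindV H.subtype σ) := by
    refine (Representation.indFun H σ).isSmoothVector_of_le hopen fun κ hκ => ?_
    obtain ⟨hκK, hκΞ⟩ := Subgroup.mem_inf.1 hκ
    rw [Representation.mem_stabilizerSubgroup]
    exact Subtype.ext (funext fun x => hFK κ hκK ((MonoidHom.mem_ker).1 hκΞ) x)
  refine ⟨(⟨⟨F, hFmem⟩, hFsm⟩ : ↥(Representation.smoothInd H σ).toSubmodule), fun b κ hκ => ?_⟩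
  change F _ = _
  rw [hF _ b κ hκ rfl, hSapp, Units.val_mul]

/-! ## §2 The `H`-period of the cut-off `1_K · f`: `∫_H Ξ(b)⁻¹ (1_K f)(b x) dμ_H(b) = μ_H(H ∩ K) · f(x)` -/

/-- **THE `H`-PERIOD OF THE CUT-OFF**: for `f ∈ Ind_H^G(Ξ|_H · δ_H)`, a compact open subgroup `K` with `G = H · K`, a Haar measure `μ_H` on `H` and
EVERY `x ∈ G`: `∫_H Ξ(b)⁻¹ · (1_K f)(b x) dμ_H(b) = μ_H(H ∩ K) · f(x)`.  For `x = κ ∈ K` the integrand is `1_{H ∩ K}(b) · f(κ)` (`f(b κ) = Ξ(b) δ_H(b) f(κ)`,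
`δ_H = 1` on `H ∩ K`); for `x = b₁ κ₁` substitute `b ↦ b b₁` (`map (· * b₁) μ_H = δ_H(b₁) • μ_H`) and use `f(b₁ κ₁) = Ξ(b₁) δ_H(b₁) f(κ₁)`.
[cite: BernsteinZelevinsky1976, §2.29] [cite: BernsteinZelevinsky1977, §1.8] [cite: CartierCorvallis1979, §IV.1] -/
theorem SmoothInd.integral_charInv_mul_indicator_toFun_eq [MeasurableSpace G] [BorelSpace G]
    (hH : IsClosed (H : Set G))
    (hσ : ∀ (b : ↥H) (z : ℂ), σ b z = ((Ξ b : ℂˣ) : ℂ) * ((deltaChar H b : ℂˣ) : ℂ) * z)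
    {K : Subgroup G} (hKc : IsCompact (K : Set G)) (hKo : IsOpen (K : Set G))
    (hGK : ∀ g : G, ∃ h : ↥H, ∃ κ ∈ K, g = h * κ)
    (μH : Measure ↥H) [μH.IsHaarMeasure] [μH.InnerRegular] (f : Representation.SmoothInd H σ) (x : G) :
    ∫ b : ↥H, ((Ξ (b : G)⁻¹ : ℂˣ) : ℂ) * (K : Set G).indicator f.toFun ((b : G) * x) ∂μH =
      (μH.real (Subtype.val ⁻¹' (K : Set G)) : ℂ) * f.toFun x := by
  -- `δ_H = 1` on `H ∩ K`
  have hδ1 : ∀ c : ↥H, (c : G) ∈ K → deltaChar H c = 1 := fun c hc =>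
    deltaChar_eq_one_of_mem_of_isCompact H (C := K.comap H.subtype) (hH.isClosedEmbedding_subtypeVal.isCompact_preimage hKc) hc
  have hSmeas : MeasurableSet (Subtype.val ⁻¹' (K : Set G) : Set ↥H) := (hKo.preimage continuous_subtype_val).measurableSet
  -- the inner identity on `K`
  have hK : ∀ κ : G, κ ∈ K →
      ∫ b : ↥H, ((Ξ (b : G)⁻¹ : ℂˣ) : ℂ) * (K : Set G).indicator f.toFun ((b : G) * κ) ∂μH =
        (μH.real (Subtype.val ⁻¹' (K : Set G)) : ℂ) * f.toFun κ := by
    intro κ hκ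
    have hpt : ∀ b : ↥H, ((Ξ (b : G)⁻¹ : ℂˣ) : ℂ) * (K : Set G).indicator f.toFun ((b : G) * κ) =
        (Subtype.val ⁻¹' (K : Set G) : Set ↥H).indicator (fun _ => f.toFun κ) b := by
      intro b
      by_cases hb : (b : G) ∈ K
      · have hbκ : (b : G) * κ ∈ (K : Set G) := K.mul_mem hb hκ
        rw [Set.indicator_of_mem hbκ, Set.indicator_of_mem (show b ∈ Subtype.val ⁻¹' (K : Set G) from hb),
          Representation.SmoothInd.toFun_subgroup_mul, hσ, hδ1 b hb, Units.val_one, mul_one, ← mul_assoc, ← Units.val_mul, ← map_mul,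
          inv_mul_cancel, map_one, Units.val_one, one_mul]
      · have hbκ : (b : G) * κ ∉ (K : Set G) := fun h => hb (by
          have := K.mul_mem h (K.inv_mem hκ)
          rwa [mul_inv_cancel_right] at this)
        rw [Set.indicator_of_notMem hbκ, Set.indicator_of_notMem (show b ∉ Subtype.val ⁻¹' (K : Set G) from hb), mul_zero]
    rw [show (fun b : ↥H => ((Ξ (b : G)⁻¹ : ℂˣ) : ℂ) * (K : Set G).indicator f.toFun ((b : G) * κ)) =
        (Subtype.val ⁻¹' (K : Set G) : Set ↥H).indicator (fun _ => f.toFun κ) from funext hpt,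
      integral_indicator_const _ hSmeas, Complex.real_smul]
  -- Iwasawa `x = b₁ κ₁` and the modular substitution
  obtain ⟨b₁, κ₁, hκ₁, hx⟩ := hGK x
  have hmap : μH.map (fun b => b * b₁) = modularCharacterFun b₁ • μH := map_right_mul_eq_modularCharacterFun_smul μH b₁
  obtain ⟨Φ, hΦ⟩ : ∃ Φ : ↥H → ℂ, Φ = fun b' : ↥H => ((Ξ (b₁ : G) : ℂˣ) : ℂ) *
      (((Ξ (b' : G)⁻¹ : ℂˣ) : ℂ) * (K : Set G).indicator f.toFun ((b' : G) * κ₁)) := ⟨_, rfl⟩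
  have hΦeq : ∀ b : ↥H, ((Ξ (b : G)⁻¹ : ℂˣ) : ℂ) * (K : Set G).indicator f.toFun ((b : G) * x) = Φ (b * b₁) := by
    intro b
    simp only [hΦ]
    rw [hx, Subgroup.coe_mul, ← mul_assoc (b : G) (b₁ : G) κ₁, ← mul_assoc, ← Units.val_mul, ← map_mul, mul_inv_rev, mul_inv_cancel_left]
  have hsub : ∫ b : ↥H, Φ (b * b₁) ∂μH = (modularCharacterFun b₁ : ℝ≥0) • ∫ b, Φ b ∂μH := by
    have hme : MeasurableEmbedding fun b : ↥H => b * b₁ := (MeasurableEquiv.mulRight b₁).measurableEmbedding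
    rw [← hme.integral_map Φ, hmap, integral_smul_nnreal_measure]
  calc ∫ b : ↥H, ((Ξ (b : G)⁻¹ : ℂˣ) : ℂ) * (K : Set G).indicator f.toFun ((b : G) * x) ∂μH
      = ∫ b : ↥H, Φ (b * b₁) ∂μH := integral_congr_ae (Filter.Eventually.of_forall hΦeq)
    _ = (modularCharacterFun b₁ : ℝ≥0) • ∫ b, Φ b ∂μH := hsub
    _ = (modularCharacterFun b₁ : ℝ≥0) • (((Ξ (b₁ : G) : ℂˣ) : ℂ) * ((μH.real (Subtype.val ⁻¹' (K : Set G)) : ℂ) * f.toFun κ₁)) := by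
        simp only [hΦ]
        rw [integral_const_mul, hK κ₁ hκ₁]
    _ = (μH.real (Subtype.val ⁻¹' (K : Set G)) : ℂ) * f.toFun x := by
        rw [hx, Representation.SmoothInd.toFun_subgroup_mul, hσ, deltaChar_apply, NNReal.smul_def, Complex.real_smul]
        change ((modularCharacter b₁ : ℝ≥0) : ℂ) * _ = _
        ring

/-! ## §3 The functional `q(f) = ∫_K Ξ(κ)⁻¹ f(κ) dμ_K`: non-zero and `(G, Ξ)`-equivariant -/

/-- **THE `Ξ`-QUOTIENT OF `Ind_H^G(Ξ|_H · δ_H)`** (`G` unimodular): with `σ(b) = Ξ(b) δ_H(b)` on the closed subgroup `H`, `Ξ` continuous with open kernel,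
`K` compact open with `G = H · K`, a Haar measure `ν` on `G` that is also right invariant, Haar measures `μ_H`, `μ_K`, the swapped `G = H · K`
disintegration `∫_G F dν = C ∫_K ∫_H F(b k) dμ_H dμ_K` (`C > 0`) and any realisation `π` of right translation on `Ind_H^G σ` (`(π g f)(x) = f(x g)`):
there is a linear functional `q` with `q ≠ 0` and `q(π(g) f) = Ξ(g) · q(f)` for all `g`, `f`.  `q(f) := ∫_K Ξ(κ⁻¹) f(κ) dμ_K`; `q(f₀) = μ_K(K) ≠ 0` on
the `Ξ`-spherical vector (§1); equivariance from §2: `∫_G Ξ(y⁻¹) (1_K f)(y g) dν(y) = C · μ_H(H ∩ K) · q(π(g) f)` and, by right invariance,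
`= Ξ(g) · ∫_G Ξ(y⁻¹) (1_K f)(y) dν(y) = Ξ(g) · C · μ_H(H ∩ K) · q(f)`.
[cite: BernsteinZelevinsky1976, §2.29] [cite: BernsteinZelevinsky1977, §1.8] [cite: Casselman1995, §3.1, Prop. 6.4.1] [cite: CartierCorvallis1979, §IV.1] -/
theorem SmoothInd.exists_charQuotientFunctional [MeasurableSpace G] [BorelSpace G] [SecondCountableTopology G] [LocallyCompactSpace G] [T2Space G]
    (hH : IsClosed (H : Set G))
    (hσ : ∀ (b : ↥H) (z : ℂ), σ b z = ((Ξ b : ℂˣ) : ℂ) * ((deltaChar H b : ℂˣ) : ℂ) * z)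
    (hΞc : Continuous fun g => ((Ξ g : ℂˣ) : ℂ)) (hΞo : IsOpen ((Ξ.ker : Subgroup G) : Set G))
    {K : Subgroup G} (hKc : IsCompact (K : Set G)) (hKo : IsOpen (K : Set G))
    (hGK : ∀ g : G, ∃ h : ↥H, ∃ κ ∈ K, g = h * κ)
    (ν : Measure G) [ν.IsHaarMeasure] [ν.IsMulRightInvariant] (μH : Measure ↥H) [μH.IsHaarMeasure]
    (μK : Measure ↥K) [μK.IsHaarMeasure] {C : ℝ} (hC : 0 < C)
    (hform : ∀ F : G → ℂ, Continuous F → HasCompactSupport F →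
      ∫ g, F g ∂ν = C * ∫ k : ↥K, ∫ b : ↥H, F ((b : G) * k) ∂μH ∂μK)
    (π : Representation ℂ G (Representation.SmoothInd H σ)) (hπ : ∀ g f x, (π g f).toFun x = f.toFun (x * g)) :
    ∃ q : Representation.SmoothInd H σ →ₗ[ℂ] ℂ, (∃ f, q f ≠ 0) ∧
      ∀ (g : G) (f : Representation.SmoothInd H σ), q (π g f) = ((Ξ g : ℂˣ) : ℂ) * q f := by
  classical
  have hKcl : IsClosed (K : Set G) := hKc.isClosed
  haveI : CompactSpace ↥K := isCompact_iff_compactSpace.1 hKc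
  haveI : SecondCountableTopology ↥H := TopologicalSpace.Subtype.secondCountableTopology _
  haveI : μH.InnerRegular := inferInstance
  -- `φ_f = 1_K · f` is locally constant
  have hφlc : ∀ f : Representation.SmoothInd H σ, IsLocallyConstant ((K : Set G).indicator f.toFun) := by
    intro f
    rw [IsLocallyConstant.iff_exists_open]
    intro y
    by_cases hy : y ∈ (K : Set G)
    · obtain ⟨U, hU, hyU, hUc⟩ := (IsLocallyConstant.iff_exists_open _).1 (SmoothInd.isLocallyConstant_toFun f) y
      refine ⟨U ∩ (K : Set G), hU.inter hKo, ⟨hyU, hy⟩, fun y' hy' => ?_⟩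
      rw [Set.indicator_of_mem hy'.2, Set.indicator_of_mem hy, hUc y' hy'.1]
    · refine ⟨(K : Set G)ᶜ, hKcl.isOpen_compl, hy, fun y' hy' => ?_⟩
      rw [Set.indicator_of_notMem hy', Set.indicator_of_notMem hy]
  -- integrability on `K`
  have hint : ∀ f : Representation.SmoothInd H σ,
      Integrable (fun k : ↥K => ((Ξ (k : G)⁻¹ : ℂˣ) : ℂ) * f.toFun k) μK := by
    intro f
    have hc : Continuous fun k : ↥K => ((Ξ (k : G)⁻¹ : ℂˣ) : ℂ) * f.toFun k :=
      (hΞc.comp continuous_subtype_val.inv).mul ((SmoothInd.isLocallyConstant_toFun f).continuous.comp continuous_subtype_val)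
    exact integrableOn_univ.1 (hc.continuousOn.integrableOn_compact isCompact_univ)
  -- the functional
  let q : Representation.SmoothInd H σ →ₗ[ℂ] ℂ :=
    { toFun := fun f => ∫ k : ↥K, ((Ξ (k : G)⁻¹ : ℂˣ) : ℂ) * f.toFun k ∂μK
      map_add' := fun f f' => by
        simp only [Representation.SmoothInd.toFun_add, Pi.add_apply, mul_add]
        exact integral_add (hint f) (hint f')
      map_smul' := fun c f => by
        simp only [Representation.SmoothInd.toFun_smul, Pi.smul_apply, smul_eq_mul, RingHom.id_apply]
        rw [← integral_const_mul]
        refine integral_congr_ae (Filter.Eventually.of_forall fun k => ?_)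
        ring }
  have hq : ∀ f, q f = ∫ k : ↥K, ((Ξ (k : G)⁻¹ : ℂˣ) : ℂ) * f.toFun k ∂μK := fun f => rfl
  -- (P) the `H`-period, constant `m = μ_H(H ∩ K) > 0`
  obtain ⟨m, hm⟩ : ∃ m : ℝ, m = μH.real (Subtype.val ⁻¹' (K : Set G)) := ⟨_, rfl⟩
  have hP : ∀ (f : Representation.SmoothInd H σ) (x : G),
      ∫ b : ↥H, ((Ξ (b : G)⁻¹ : ℂˣ) : ℂ) * (K : Set G).indicator f.toFun ((b : G) * x) ∂μH = (m : ℂ) * f.toFun x := by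
    intro f x
    rw [hm]
    exact SmoothInd.integral_charInv_mul_indicator_toFun_eq hH hσ hKc hKo hGK μH f x
  have hm0 : (0 : ℝ) < m := by
    rw [hm, Measure.real]
    refine ENNReal.toReal_pos (ne_of_gt (IsOpen.measure_pos μH (hKo.preimage continuous_subtype_val) ⟨1, K.one_mem⟩)) ?_
    exact ((hH.isClosedEmbedding_subtypeVal.isCompact_preimage hKc).measure_lt_top).ne
  -- (Q) `∫_G Ξ(y⁻¹) φ_f(y g) dν = C · m · q(π g f)`
  have hQ : ∀ (f : Representation.SmoothInd H σ) (g : G),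
      ∫ y : G, ((Ξ y⁻¹ : ℂˣ) : ℂ) * (K : Set G).indicator f.toFun (y * g) ∂ν = (C : ℂ) * ((m : ℂ) * q (π g f)) := by
    intro f g
    have hcont : Continuous fun y : G => ((Ξ y⁻¹ : ℂˣ) : ℂ) * (K : Set G).indicator f.toFun (y * g) :=
      (hΞc.comp continuous_inv).mul ((hφlc f).continuous.comp (continuous_mul_const g))
    have hsupp : HasCompactSupport fun y : G => ((Ξ y⁻¹ : ℂˣ) : ℂ) * (K : Set G).indicator f.toFun (y * g) := by
      refine HasCompactSupport.intro (hKc.image (continuous_mul_const g⁻¹)) fun y hy => ?_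
      have hyg : y * g ∉ (K : Set G) := fun h => hy ⟨y * g, h, by simp⟩
      rw [Set.indicator_of_notMem hyg, mul_zero]
    rw [hform _ hcont hsupp]
    congr 1
    rw [hq, ← integral_const_mul]
    refine integral_congr_ae (Filter.Eventually.of_forall fun k => ?_)
    change ∫ b : ↥H, ((Ξ ((b : G) * (k : G))⁻¹ : ℂˣ) : ℂ) * (K : Set G).indicator f.toFun ((b : G) * (k : G) * g) ∂μH =
      (m : ℂ) * (((Ξ (k : G)⁻¹ : ℂˣ) : ℂ) * (π g f).toFun k)
    have e2 : ∀ b : ↥H, ((Ξ ((b : G) * (k : G))⁻¹ : ℂˣ) : ℂ) * (K : Set G).indicator f.toFun ((b : G) * (k : G) * g) =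
        ((Ξ (k : G)⁻¹ : ℂˣ) : ℂ) * (((Ξ (b : G)⁻¹ : ℂˣ) : ℂ) * (K : Set G).indicator f.toFun ((b : G) * ((k : G) * g))) := by
      intro b
      rw [mul_inv_rev, map_mul, Units.val_mul, mul_assoc, mul_assoc]
    rw [show (fun b : ↥H => ((Ξ ((b : G) * (k : G))⁻¹ : ℂˣ) : ℂ) * (K : Set G).indicator f.toFun ((b : G) * (k : G) * g)) =
        fun b : ↥H => ((Ξ (k : G)⁻¹ : ℂˣ) : ℂ) * (((Ξ (b : G)⁻¹ : ℂˣ) : ℂ) * (K : Set G).indicator f.toFun ((b : G) * ((k : G) * g))) from funext e2,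
      integral_const_mul, hP f ((k : G) * g), hπ g f k]
    ring
  -- (R) right translation: `∫_G Ξ(y⁻¹) φ_f(y g) dν = Ξ(g) ∫_G Ξ(y⁻¹) φ_f(y) dν`
  have hR : ∀ (f : Representation.SmoothInd H σ) (g : G),
      ∫ y : G, ((Ξ y⁻¹ : ℂˣ) : ℂ) * (K : Set G).indicator f.toFun (y * g) ∂ν =
        ((Ξ g : ℂˣ) : ℂ) * ∫ y : G, ((Ξ y⁻¹ : ℂˣ) : ℂ) * (K : Set G).indicator f.toFun (y * 1) ∂ν := by
    intro f g
    obtain ⟨Ψ, hΨ⟩ : ∃ Ψ : G → ℂ, Ψ = fun y' : G => ((Ξ g : ℂˣ) : ℂ) * (((Ξ y'⁻¹ : ℂˣ) : ℂ) * (K : Set G).indicator f.toFun (y' * 1)) :=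
      ⟨_, rfl⟩
    have e3 : ∀ y : G, ((Ξ y⁻¹ : ℂˣ) : ℂ) * (K : Set G).indicator f.toFun (y * g) = Ψ (y * g) := by
      intro y
      rw [hΨ]
      dsimp only
      rw [mul_one, mul_inv_rev, map_mul, Units.val_mul, ← mul_assoc, ← mul_assoc, ← Units.val_mul, ← map_mul, mul_inv_cancel, map_one,
        Units.val_one, one_mul]
    calc ∫ y : G, ((Ξ y⁻¹ : ℂˣ) : ℂ) * (K : Set G).indicator f.toFun (y * g) ∂ν
        = ∫ y : G, Ψ (y * g) ∂ν := integral_congr_ae (Filter.Eventually.of_forall e3)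
      _ = ∫ y : G, Ψ y ∂ν := integral_mul_right_eq_self Ψ g
      _ = ((Ξ g : ℂˣ) : ℂ) * ∫ y : G, ((Ξ y⁻¹ : ℂˣ) : ℂ) * (K : Set G).indicator f.toFun (y * 1) ∂ν := by
          rw [hΨ]
          exact integral_const_mul _ _
  refine ⟨q, ?_, fun g f => ?_⟩
  · -- `q(f₀) = μ_K(K) ≠ 0`
    obtain ⟨f₀, hf₀⟩ := SmoothInd.exists_charSpherical hH hσ hΞo hKc hKo hGK
    refine ⟨f₀, ?_⟩
    have hval : ∀ k : ↥K, ((Ξ (k : G)⁻¹ : ℂˣ) : ℂ) * f₀.toFun k = 1 := by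
      intro k
      have h1 := hf₀ 1 (k : G) k.2
      rw [Subgroup.coe_one, one_mul, map_one, map_one, Units.val_one, one_mul, one_mul] at h1
      rw [h1, ← Units.val_mul, ← map_mul, inv_mul_cancel, map_one, Units.val_one]
    rw [hq, show (fun k : ↥K => ((Ξ (k : G)⁻¹ : ℂˣ) : ℂ) * f₀.toFun k) = fun _ => (1 : ℂ) from funext hval, integral_const, Complex.real_smul,
      mul_one]
    have hpos : (0 : ℝ) < μK.real Set.univ := by
      rw [Measure.real]
      exact ENNReal.toReal_pos (ne_of_gt (IsOpen.measure_pos μK isOpen_univ Set.univ_nonempty)) (measure_lt_top μK _).ne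
    exact_mod_cast hpos.ne'
  · -- equivariance
    have key : (C : ℂ) * ((m : ℂ) * q (π g f)) = ((Ξ g : ℂˣ) : ℂ) * ((C : ℂ) * ((m : ℂ) * q (π 1 f))) := by
      rw [← hQ f g, hR f g, hQ f 1]
    rw [map_one, Module.End.one_apply] at key
    have hCm : (C : ℂ) * (m : ℂ) ≠ 0 := mul_ne_zero (by exact_mod_cast hC.ne') (by exact_mod_cast hm0.ne')
    have key' : ((C : ℂ) * (m : ℂ)) * q (π g f) = ((C : ℂ) * (m : ℂ)) * (((Ξ g : ℂˣ) : ℂ) * q f) := by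
      rw [mul_assoc, key]
      ring
    exact mul_left_cancel₀ hCm key'

end Literature.NumberTheory.Automorphic

end
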